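import Literature.MathematicalPhysics.QuantumFieldTheory.Balaban1983to89.B7Prop4Flat
import Literature.MathematicalPhysics.QuantumFieldTheory.Balaban1983to89.B5Hk163Torus
import Literature.MathematicalPhysics.QuantumFieldTheory.Balaban1983to89.B6LowerBound2153Torus
import HarnessLib

/-!
# NE7FlatAverageBridge — BRICK 1 OF THE BRIDGE lit-balaban ↔ T4 DICTIONARY AT `U = 1`: the T4 straight-line block average `B7Prop3Flat.linQ` of the
# ℤ^d-periodic pull-back of a fine torus 1-form IS lit-balaban's typed averaging operator `B5Block118.QvOp` ((1.18)) up to the factor `n = L^k`: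
# `linQ n (A ∘ toT) (n•rep y) κ = n·(Q_k A)(y, κ)`, hence `linQIter L (A ∘ toT) k = n·(Q_k A)` read through `toT`

Cell `pub-balaban`, rung (B)+1 sub-cell t4, lineage `b2b-balaban-t4-ne7-p1`, generation 69 (CRUX PROVER NE7 #1); memo
`t4/b2b-balaban-t4-ne7-p1-g69/HUNT-H13-ROUTE-PI-TRANSPOSED.md` §5–§6 (2).  File F35.
WHY.  Memo H13 §5: (APE)'s normal part needs an EXACTNESS-PRESERVING smooth right inverse of the flat linearised average (letter (R7), LIN-ONE-STEP
TYPE) and its tangent part the SUP-NORM inverse of the flat slice operator ((L4♯), B5 (1.115) TYPE).  Both exist IN KERNEL in lit-balaban's ABELIAN TORUS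
dictionary (`B5Hk163Torus.HkOp` with `QvOp * HkOp = 1`, gen 65's `NE7LinOneStepAbelian.norm_curl_HkOp_le_curl`, `B5G115SupBound`), where the average is the
typed matrix `QvOp n M : (Tor M × Fin d) ← (Tor (fine n M) × Fin d)`, `(Q_k A)(y,μ) = η^{d+1}Σ_{x∈B^k(y)} Σ_{t<n} A(x + tηe_μ, μ)`, `η = 1∕n`.  The T4
dictionary's flat objects are `B7Prop3Flat.linQ` (`Σ_{r} L^{−d}·A(q + r + [0, L)e_κ)`, NO `L⁻¹` on the line: the coarse bond carries `L×` the potential),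
its iterate `B7Prop4Flat.linQIter` (`= linQ (L^k)` at `L^k•z`, `linQIter_eq_linQ_pow`), and row NE3's `cpush L flatCfg = linQ − d∘F̂`
(`NE3TangentFlatPush.cpush_flatCfg`).  THIS FILE identifies the two averages on ℤ^d-periodic pull-backs `x ↦ A(toT x)` of torus 1-forms — the first
brick every transfer of lit-balaban's kernel capital (`HkOp`'s exactness on gradients, LIN-ONE-STEP, (1.115)) to the T4 dictionary goes through.
WHAT ([folklore]; 0 def, 0 sorry).
§1 the residue map on the three pieces of a contour point: `toT (n•rep y) = up y`, `toT (boxVec n j) = iota j`, `toT (t•e_κ) = tstep κ t`;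
§2 **`linQ_pullback_eq`** — `linQ n (fun x μ => A (toT (fine n M) x, μ)) ((n : ℤ)•rep M y) κ = (n : ℂ)·(QvOp n M *ᵥ A) (y, κ)`;
§3 **`linQIter_pullback_eq`** — with `n = L^k`: `linQIter L (fun x μ => A (toT x, μ)) k (rep M y) κ = (L^k : ℂ)·(QvOp (L^k) M *ᵥ A)(y, κ)`.
§4 **`linQIter_pullback_HkOp`** — THE PAY-OFF: lit-balaban's Landau minimiser `H_k` ((1.63), `B5Hk163Torus.HkOp`, `Q_kH_k = 1` IN KERNEL) pulled back to
   ℤ^d is an EXACT right inverse of the T4 iterated straight-line average up to the factor `L^k`: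
   `linQIter L (x ↦ (H_kB)(toT x)) k (rep y) κ = L^k·B(y, κ)` — every kernel letter of `H_k` (exponential decay `norm_dker_bpt_le`, gauge covariance
   `Fs_HkOp_eq_of_sub_eq`, LIN-ONE-STEP `norm_curl_HkOp_le_curl`) is now a statement about a right inverse of a T4 object.
HONEST FRAMING (page 1): index bookkeeping between two typed dictionaries of the SAME printed average ([Balaban1984PropagatorsI] (1.18) p. 20 =
[Balaban1985Averaging] (122)∕(125) p. 36 at `U = 1`); nothing of Bałaban's asserted; NOT (APE), NOT ONE-STEP, NOT NE7; spine 0∕9; finite T⁴ rung (B)+1 —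
NOT infinite volume, NOT mass gap, NOT Clay.  Continuum YM on T⁴ ⇐ BetaPertH ∧ nine spine estimates (0/9 proved); BetaPertH ⇐ (D1) ∧ (D4) ∧ CAP+tail;
G-an2-4 gates asym, D1 and NE2/3/4.
-/

set_option autoImplicit false

open scoped BigOperators Matrix
open Finset

namespace Summit.QuantumFields.BalabanUV.T4Continuum.NE7FlatAverageBridge

open Literature.MathematicalPhysics.QuantumFieldTheory.Balaban1983to89
open B7Prop1Explicit (Site e e_apply boxVec)
open B7Prop3Flat (linQ)
open B7Prop4Flat (linQ_eq_sum linQIter linQIter_eq_linQ_pow)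
open B5Prop11Plancherel (Tor fine)
open B5Block118 (bpt up iota tstep lineSum QvOp QvOp_mulVec upHom_intCast)
open B5Hk163Torus (HkOp QvOp_HkOp_mulVec)
open B6LowerBound2153Torus (toT rep toT_add)

noncomputable section

variable {d : ℕ} (n : ℕ) [NeZero n] (M : Fin d → ℕ) [hM : ∀ μ, NeZero (M μ)]

/-! ## §1 The residue map on the pieces of a contour point -/

omit [NeZero n] in
/-- `toT_{nM} (n • rep_M y) = up y`: the corner of the coarse point `y` read on the fine torus. [folklore] -/
theorem toT_nsmul_rep (y : Tor M) : toT (fine n M) ((n : ℤ) • rep M y) = up n M y := by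
  funext ν
  have hy : (y ν : ZMod (M ν)) = (((y ν).val : ℤ) : ZMod (M ν)) := by
    rw [Int.cast_natCast, ZMod.natCast_zmod_val]
  simp only [toT, up, rep, Pi.smul_apply, smul_eq_mul]
  conv_rhs => rw [hy, upHom_intCast]
  push_cast
  ring

omit [NeZero n] hM in
/-- `toT_{nM} (boxVec n j) = iota j`: the block offset. [folklore] -/
theorem toT_boxVec (j : Fin d → Fin n) : toT (fine n M) (boxVec n j) = iota n M j := by
  funext ν
  simp only [toT, boxVec, iota, Int.cast_natCast]

omit [NeZero n] hM in
/-- `toT_{nM} (t • e_κ) = tstep κ t`: the step along the line. [folklore] -/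
theorem toT_tsmul_e (κ : Fin d) (t : ℕ) : toT (fine n M) (((t : ℕ) : ℤ) • e κ) = tstep (fine n M) κ t := by
  funext ν
  simp only [toT, tstep, Pi.smul_apply, smul_eq_mul, e_apply]
  by_cases h : ν = κ
  · subst h; simp
  · simp [h]

/-! ## §2 The one-shot average: `linQ n (A ∘ toT) = n·Q_k A` -/

/-- **THE T4 STRAIGHT-LINE AVERAGE OF A PULL-BACK IS lit-balaban's `Q_k` TIMES `n`**:
`linQ n (x ↦ A(toT x)) (n•rep y) κ = n·(QvOp n M *ᵥ A)(y, κ)`. [folklore] -/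
theorem linQ_pullback_eq (A : Tor (fine n M) × Fin d → ℂ) (y : Tor M) (κ : Fin d) :
    linQ n (fun (x : Site d) (μ : Fin d) => A (toT (fine n M) x, μ)) ((n : ℤ) • rep M y) κ
      = (n : ℂ) * (QvOp n M *ᵥ A) (y, κ) := by
  rw [linQ_eq_sum, QvOp_mulVec]
  have hn : (n : ℂ) ≠ 0 := by exact_mod_cast (NeZero.ne n)
  -- each contour point is `bpt y r + tstep κ t` on the fine torus
  have hpt : ∀ (r : Fin d → Fin n) (i : Fin n),
      toT (fine n M) ((n : ℤ) • rep M y + boxVec n r + ((i : ℕ) : ℤ) • e κ) = bpt n M y r + tstep (fine n M) κ i := by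
    intro r i
    rw [toT_add, toT_add, toT_nsmul_rep, toT_boxVec, toT_tsmul_e]
    rfl
  simp_rw [hpt]
  -- the real scalar `((n:ℝ)^d)⁻¹` acts as the complex number `((n:ℂ)^d)⁻¹`
  have hsmul : ∀ z : ℂ, (((n : ℝ) ^ d)⁻¹ : ℝ) • z = (((n : ℂ) ^ d)⁻¹) * z := fun z => by
    rw [Complex.real_smul]; push_cast; ring
  simp_rw [hsmul, ← Finset.mul_sum]
  unfold lineSum
  field_simp
  ring

/-! ## §3 The iterated average -/

/-- **THE `k`-FOLD ITERATE** (`n = L^k`): `linQIter L (x ↦ A(toT x)) k (rep y) κ = (L^k : ℂ)·(QvOp (L^k) M *ᵥ A)(y, κ)` — by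
`B7Prop4Flat.linQIter_eq_linQ_pow` the T4 iterate is the one-shot `linQ (L^k)` at `L^k•z`. [folklore] -/
theorem linQIter_pullback_eq (L k : ℕ) [NeZero (L ^ k)] (A : Tor (fine (L ^ k) M) × Fin d → ℂ) (y : Tor M) (κ : Fin d) :
    linQIter L (fun (x : Site d) (μ : Fin d) => A (toT (fine (L ^ k) M) x, μ)) k (rep M y) κ
      = ((L ^ k : ℕ) : ℂ) * (QvOp (L ^ k) M *ᵥ A) (y, κ) := by
  rw [linQIter_eq_linQ_pow, linQ_pullback_eq]

/-! ## §4 The pay-off: `H_k` pulled back is an exact right inverse of the T4 iterated average -/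

/-- **lit-balaban's `H_k` IS AN EXACT RIGHT INVERSE OF THE T4 ITERATED STRAIGHT-LINE AVERAGE (up to `L^k`)**: for every coarse torus 1-form `B`,
`linQIter L (x ↦ (HkOp (L^k) M *ᵥ B)(toT x)) k (rep y) κ = L^k·B(y, κ)` (`B5Hk163Torus.QvOp_HkOp_mulVec`: `Q_k(H_kB) = B`). [folklore] -/
theorem linQIter_pullback_HkOp (L k : ℕ) [NeZero (L ^ k)] (B : Tor M × Fin d → ℂ) (y : Tor M) (κ : Fin d) :
    linQIter L (fun (x : Site d) (μ : Fin d) => (HkOp (L ^ k) M *ᵥ B) (toT (fine (L ^ k) M) x, μ)) k (rep M y) κ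
      = ((L ^ k : ℕ) : ℂ) * B (y, κ) := by
  rw [linQIter_pullback_eq, QvOp_HkOp_mulVec]

end

end Summit.QuantumFields.BalabanUV.T4Continuum.NE7FlatAverageBridge
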